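import Literature.Probability.RandomPlanarGeometry.CrossingCondition
import HarnessLib

/-!
# The Kemppainen–Smirnov condition (G2) for a chordal curve family — one constant, all domains, all scales

Topic `Literature/Probability/RandomPlanarGeometry`; definition item
`defn-ChordalFamily.SatisfiesKSCondition` (consumer: crux `EuclideanLocalRigiditySLE6`,
`stmt-CriticalPhenomena-6806`, route CardyLocalRigidity; the same clause is inlined as `G2` in
route CardyScaleErgodic as `ConditionG2 (range fun D => ⟨D.carrier, D.pt 0, D.pt 1, P D⟩)`).

## Source

A. Kemppainen, S. Smirnov, *Random curves, scaling limits and Loewner evolutions*, Ann. Probab.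
45 (2017) 698–779 (arXiv:1212.6215). §1.1 "The setup and the assumptions": a collection `Σ` of
pairs `(φ, P)` — `U = U(φ)` a simply connected domain, `a = φ⁻¹(-1)`, `b = φ⁻¹(1)`, `P` a law on
curves —, annuli `A(z₀, r, R)` (eq. (2)), the avoidable set `A^u` (eq. (3)) and the time-zero
Condition G1 (eq. (4)); §2.1.3 "Four equivalent conditions", **Condition G2** (geometric bound
on an unforced crossing), verbatim:

> The family `Σ` is said to satisfy a geometric bound on an unforced crossing if there exists
> `C > 1` such that for any `(φ, P) ∈ Σ`, for any stopping time `0 ≤ τ ≤ 1` and for any annulus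
> `A = A(z₀, r, R)` where `0 < C r ≤ R`,
> `P( γ[τ, 1] makes a crossing of A which is contained in A^u_τ ∣ γ[0, τ] ) < 1/2.`

Here `A^u_τ` is the avoidable part of `A` in `U_τ = U ∖ γ[0, τ]` (Def. 2.3; tree: `unforcedPart`).
Further: Prop. 2.6 (G2 ⇔ G3 ⇔ C2 ⇔ C3, all conformally invariant; C2 is the "conformal twin"
with topological quadrilaterals), Cor. 2.7 (the constant `1/2` may be replaced by any number in
`(0, 1)`), Remark 2.9 (under the domain Markov property the time-zero condition G1 already
implies G2), the main theorem (Thm 1.5; Thm 1.3 of the arXiv version: G2 ⇒ tightness and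
Loewner regularity of subsequential limits), §4 (G2 verified for the critical FK-Ising and
site-percolation interfaces from RSW-type crossing bounds, for the harmonic explorer and for
chordal LERW; §4.5: it fails for the UST Peano curve).
NUMBERING: §2.1 items are cited in the journal numbering used by `CrossingCondition.lean`
(Lemma 2.1, Remark 2.2, Def. 2.3, Prop. 2.6, Cor. 2.7, Remark 2.9); in the arXiv text (the copy
read for this file) they are Lemma 2.1, Def. 2.2, Prop. 2.5, Cor. 2.6, Remark 2.8, and
Prop. 4.3 / §4.1.4 / §4.2 below are arXiv numbers. Condition names G1, G2, C2, … and
eq. (2)–(4) agree.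

## Contents

* `ChordalFamily.markedLaws P` — the Kemppainen–Smirnov collection
  `Σ_P = {(D, a, b, P D) : D a Dobrushin domain}` of a chordal family, as a `Set MarkedLaw`.
* **`ChordalFamily.SatisfiesKSCondition P C`** — Condition G2 for `Σ_P` WITH THE GIVEN CONSTANT
  `C`: `1 < C`, and for every Dobrushin domain `D`, every first hitting time `τ_F` of a nonempty
  closed set `F ⊆ ℂ` (the stopping times of KS Lemma 2.1), every annulus `A(z₀, r, R)` with
  `0 < r`, `C r ≤ R`, and every measurable set `S` of pasts,
  `P D ({γ[0, τ_F] ∈ S} ∩ {γ[τ_F, 1] crosses A inside A^u_{τ_F}}) ≤ ½ · P D {γ[0, τ_F] ∈ S}`,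
  the integrated form of the conditional bound — literally the body of `ConditionG2`
  (`CrossingCondition.lean`) at the element `(D.carrier, D.pt 0, D.pt 1, P D)` of `Σ_P`.
* API: unfolding (`satisfiesKSCondition_iff`), `one_lt`, `bound`, monotonicity in `C` (`mono`),
  the unconditional bound (`measure_le`, `measure_le_half`), the bridge
  `(∃ C, P.SatisfiesKSCondition C) ↔ ConditionG2 P.markedLaws`, the time-zero consequence
  (`crossingIn_unforcedPartZero_le`; Condition G1 for `Σ_P` when `P` is chordal, `conditionG1`),
  and non-vacuity / scope examples (`tipFamily` and `arcFamily` satisfy it for every `C > 1`).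

## What is printed and what is added (faithfulness notes)

* PRINTED: ONE constant `C` for the whole collection `Σ`, for all stopping times and for all
  annuli with `0 < C r ≤ R`; KS's G2 is already uniform over `Σ`, over the past and over scales.
  `SatisfiesKSCondition P C` is precisely this for the collection `Σ_P` of ALL Dobrushin domains
  (all positions, sizes and shapes) with the laws `P D` (compare KS Prop. 4.3 and §4.2, where `Σ_{FK Ising}` and the
  percolation collection are indexed by ALL admissible lattice domains).
* THE ADDITION flagged by the requester is the choice `Σ := Σ_P` together with the explicit
  constant: KS prove Thm 1.3 for an arbitrary collection, typically a sequence `(φ_n, P_n)` of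
  lattice interfaces approximating one domain, for which uniformity in the scale `r` is automatic
  below the mesh (§4.1.4: points of the polygonal interface stay `2η` apart from `∂U` and from
  each other, "we can use this to deal with the scales smaller than `η` when checking the
  condition") and an RSW statement above it. For a continuum family `P`, not assumed scale
  covariant, ONE `C` for every `D` and every `0 < r ≤ R / C` is a restriction at every scale
  separately: it forbids, e.g., families that look critical at small scales and degenerate at
  large ones (near-critical / massive perturbations). The per-domain variant `∀ D, ∃ C_D, …`
  would be KS's G2 for the singletons `{(D, P D)}`; it is NOT what is defined here.
* CONVENTIONS (those of `ConditionG2`, whose module docstring records the wording risks):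
  stopping times are the first hitting times `τ_F` of nonempty closed sets (KS Lemma 2.1 and
  Remark 2.2: the stopping times used in the proof of Thm 1.3 are of this type); pasts and futures
  are `CurveClass.stopAt F`, `CurveClass.startFrom F` (`ChordalCurveFamily.lean`); the bound on the
  conditional probability is stated integrated against the `σ(γ[0, τ_F])`-events `{stopAt F ∈ S}`;
  `≤ 1/2` replaces `< 1/2` (immaterial by Cor. 2.7, and the form that survives integration).
  Formally the printed G2 (all stopping times, strict inequality) implies this one.
* SCOPE, exactly as printed: a crossing "contained in `A^u_τ`" has its interior in
  `A^u_τ ⊆ U_τ ∩ A`, an OPEN set inside the domain; pieces of curve running inside `∂D` make no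
  such crossing. KS assume `P` carried by simple curves with `γ(0, 1) ⊂ U`; that support
  hypothesis, like `ChordalFamily.IsChordal` / `CurveClass.simple` and the domain Markov property,
  is NOT part of the condition (it belongs to the theorems consuming it). Witness of the scope:
  the boundary-arc family `arcFamily` satisfies the condition vacuously
  (`satisfiesKSCondition_arcFamily`), as does the degenerate `tipFamily`.
* The "Markov-extension" phrasing (a bound on the kernel `Q D past` of
  `ChordalFamily.IsMarkovExtension`) is not used: the hitting-time form needs no kernel, matches
  `ConditionG2`, and under the domain Markov property reduces to its time-zero case (KS Remark 2.9;
  here `crossingIn_unforcedPartZero_le` is the converse, trivial, direction G2 ⇒ G1).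
-/

noncomputable section

open MeasureTheory Set Filter Topology
open scoped ENNReal unitInterval

namespace Literature.Probability.RandomPlanarGeometry

/-! ### Curve surgery at a set containing the starting point (stopping at time zero) -/

namespace Curve

variable {E : Type*} [TopologicalSpace E]

/-- A curve starting in `F` has first hitting parameter `0` for `F`. [folklore] -/
theorem hitParam_eq_zero_of_source_mem {F : Set E} {γ : Curve E} (h : γ.source ∈ F) :
    γ.hitParam F = 0 :=
  le_antisymm (by simpa using (hitParam_le (F := F) (γ := γ) (t := 0) h))
    (γ.hitParam_mem_Icc F).1

/-- A curve starting in `F`, stopped when it first hits `F`, is the constant curve at its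
starting point. [folklore] -/
theorem stopAt_eq_const_of_source_mem {F : Set E} {γ : Curve E} (h : γ.source ∈ F) :
    γ.stopAt F = const γ.source := by
  refine Curve.ext (ContinuousMap.ext fun s => ?_)
  show γ.stopAt F s = const γ.source s
  rw [stopAt_apply, hitParam_eq_zero_of_source_mem h, zero_mul, const_apply, source_def,
    projIcc_left]
  rfl

/-- A curve starting in `F` is its own final segment from the first hitting of `F`. [folklore] -/
theorem startFrom_eq_self_of_source_mem {F : Set E} {γ : Curve E} (h : γ.source ∈ F) :
    γ.startFrom F = γ := by
  refine Curve.ext (ContinuousMap.ext fun s => ?_)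
  show γ.startFrom F s = γ s
  rw [startFrom_apply, hitParam_eq_zero_of_source_mem h, zero_add, sub_zero, one_mul,
    projIcc_val]

/-- The final segment is a sub-curve: its trace is part of the trace. [folklore] -/
theorem range_startFrom_subset (F : Set E) (γ : Curve E) : (γ.startFrom F).range ⊆ γ.range := by
  rintro _ ⟨s, rfl⟩
  rw [startFrom_apply]
  exact ⟨_, rfl⟩

/-- The initial segment is a sub-curve: its trace is part of the trace. [folklore] -/
theorem range_stopAt_subset (F : Set E) (γ : Curve E) : (γ.stopAt F).range ⊆ γ.range := by
  rintro _ ⟨s, rfl⟩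
  rw [stopAt_apply]
  exact ⟨_, rfl⟩

end Curve

namespace CurveClass

variable {E : Type*} [MetricSpace E]

/-- The chosen representative starts where the class starts. [folklore] -/
@[simp] theorem source_out (c : CurveClass E) : c.out.source = c.source := by
  conv_rhs => rw [← mk_out c]
  rfl

/-- The chosen representative has the trace of the class. [folklore] -/
@[simp] theorem range_out (c : CurveClass E) : c.out.range = c.range := by
  conv_rhs => rw [← mk_out c]
  rfl

/-- The trace of the class of a constant curve is a point. [folklore] -/
@[simp] theorem range_mk_const (x : E) : (mk (Curve.const x)).range = {x} := by
  rw [range_mk, Curve.range_const]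

/-- The tip of the class of a constant curve. [folklore] -/
@[simp] theorem target_mk_const (x : E) : (mk (Curve.const x)).target = x := rfl

/-- A class starting in `F`, stopped when it first hits `F`, is the class of the constant curve
at its starting point (no closedness of `F` needed). [folklore] -/
theorem stopAt_eq_of_source_mem {F : Set E} {c : CurveClass E} (h : c.source ∈ F) :
    c.stopAt F = mk (Curve.const c.source) := by
  rw [stopAt, Curve.stopAt_eq_const_of_source_mem (by rwa [source_out]), source_out]

/-- A class starting in `F` is its own final segment from the first hitting of `F`. [folklore] -/
theorem startFrom_eq_self_of_source_mem {F : Set E} {c : CurveClass E} (h : c.source ∈ F) :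
    c.startFrom F = c := by
  rw [startFrom, Curve.startFrom_eq_self_of_source_mem (by rwa [source_out]), mk_out]

/-- The trace of the final segment is part of the trace. [folklore] -/
theorem range_startFrom_subset (F : Set E) (c : CurveClass E) :
    (c.startFrom F).range ⊆ c.range := by
  rw [startFrom, range_mk, ← range_out c]
  exact Curve.range_startFrom_subset F c.out

/-- The trace of the initial segment is part of the trace. [folklore] -/
theorem range_stopAt_subset (F : Set E) (c : CurveClass E) : (c.stopAt F).range ⊆ c.range := by
  rw [stopAt, range_mk, ← range_out c]
  exact Curve.range_stopAt_subset F c.out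

/-- A class making a crossing of `A(z₀, r, R)` inside `S` visits `A ∩ S` (the interior of the
crossing sub-curve is a nonempty parameter interval). [folklore] -/
theorem exists_mem_range_of_mem_crossingIn {z₀ : ℂ} {r R : ℝ} {S : Set ℂ} {c : CurveClass ℂ}
    (h : c ∈ crossingIn z₀ r R S) : ∃ z ∈ c.range, z ∈ planarAnnulus z₀ r R ∩ S := by
  obtain ⟨γ, hγ, s, t, hst, -, hin⟩ := h
  obtain ⟨u, hsu, hut⟩ := exists_between hst
  exact ⟨γ u, by rw [← hγ, range_mk]; exact ⟨u, rfl⟩, hin u hsu hut⟩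

end CurveClass

/-! ### The avoidable set and the unforced-crossing event at time zero -/

/-- With only the starting point `a ∉ U` explored (a boundary point; `U ∖ {a} = U`), the
avoidable set `A^u_τ` of KS Def. 2.3 at `τ = 0` is the time-zero avoidable set `A^u` of KS
eq. (3). [cite: KemppainenSmirnov2017, §1.1 eq. (3) and Def. 2.3] -/
theorem unforcedPart_mk_const {U : Set ℂ} {a : ℂ} (ha : a ∉ U) (b z₀ : ℂ) (r R : ℝ) :
    unforcedPart U b (CurveClass.mk (Curve.const a)) z₀ r R = unforcedPartZero U a b z₀ r R := by
  simp only [unforcedPart, unforcedPartZero, CurveClass.range_mk_const,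
    CurveClass.target_mk_const, Set.sdiff_singleton_eq_self ha]

/-- For a curve starting at `a ∈ F` with `a ∉ U`, the unforced-crossing event observed at the
hitting time `τ_F = 0` is the event "the curve makes a crossing of `A` contained in the
time-zero avoidable set `A^u`" of Condition G1. [cite: KemppainenSmirnov2017, §1.1 eq. (3)-(4) and §2.1.3] -/
theorem mem_unforcedCrossingEvent_iff_of_source_eq {U F : Set ℂ} {a b z₀ : ℂ} {r R : ℝ}
    (ha : a ∉ U) (haF : a ∈ F) {c : CurveClass ℂ} (hc : c.source = a) :
    c ∈ unforcedCrossingEvent U b F z₀ r R ↔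
      c ∈ CurveClass.crossingIn z₀ r R (unforcedPartZero U a b z₀ r R) := by
  have h : c.source ∈ F := hc ▸ haF
  rw [mem_unforcedCrossingEvent_iff, CurveClass.startFrom_eq_self_of_source_mem h,
    CurveClass.stopAt_eq_of_source_mem h, hc, unforcedPart_mk_const ha]

/-- A curve whose trace avoids the (open) domain `U` makes no unforced crossing in `U`: the
interior of a crossing "contained in `A^u_τ`" lies in `A^u_τ ⊆ U ∖ γ[0, τ]` (KS Def. 2.3), and the
future `γ[τ_F, 1]` is a sub-curve of `γ`. In particular curves running inside `∂U` are invisible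
to Conditions G1/G2. [cite: KemppainenSmirnov2017, Def. 2.3] -/
theorem notMem_unforcedCrossingEvent_of_disjoint {U : Set ℂ} {c : CurveClass ℂ}
    (hc : Disjoint c.range U) (b : ℂ) (F : Set ℂ) (z₀ : ℂ) (r R : ℝ) :
    c ∉ unforcedCrossingEvent U b F z₀ r R := by
  intro h
  rw [mem_unforcedCrossingEvent_iff] at h
  obtain ⟨z, hz, -, hzS⟩ := CurveClass.exists_mem_range_of_mem_crossingIn h
  exact Set.disjoint_left.1 hc (CurveClass.range_startFrom_subset F c hz)
    (unforcedPart_subset _ _ _ _ _ _ hzS).1.1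

/-! ### The condition for a chordal family -/

namespace ChordalFamily

/-- The **Kemppainen–Smirnov collection of a chordal family**: `Σ_P = {(D, a, b, P D)}` over all
Dobrushin domains `(D; a, b)`, `a = D.pt 0`, `b = D.pt 1`, as marked laws `(U, a, b, P)` (KS's
pairs `(φ, P)` with `(U(φ), φ⁻¹(-1), φ⁻¹(1)) = (D, a, b)`; the uniformising map is not needed to
state G1/G2). This is the family on which route CardyScaleErgodic evaluates `ConditionG2`.
[cite: KemppainenSmirnov2017, §1.1] -/
def markedLaws (P : ChordalFamily) : Set MarkedLaw :=
  Set.range fun D : DobrushinDomain => (⟨D.carrier, D.pt 0, D.pt 1, P D⟩ : MarkedLaw)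

/-- Unfolding `markedLaws` (the form inlined in route CardyScaleErgodic). [folklore] -/
theorem markedLaws_def (P : ChordalFamily) :
    P.markedLaws =
      Set.range fun D : DobrushinDomain => (⟨D.carrier, D.pt 0, D.pt 1, P D⟩ : MarkedLaw) :=
  rfl

/-- Membership in `markedLaws`. [folklore] -/
theorem mem_markedLaws_iff {P : ChordalFamily} {L : MarkedLaw} :
    L ∈ P.markedLaws ↔
      ∃ D : DobrushinDomain, (⟨D.carrier, D.pt 0, D.pt 1, P D⟩ : MarkedLaw) = L :=
  Iff.rfl

/-- The marked law of `D` belongs to `Σ_P`. [folklore] -/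
theorem markedLaw_mem_markedLaws (P : ChordalFamily) (D : DobrushinDomain) :
    (⟨D.carrier, D.pt 0, D.pt 1, P D⟩ : MarkedLaw) ∈ P.markedLaws :=
  ⟨D, rfl⟩

/-- **The Kemppainen–Smirnov condition with constant `C` for a chordal family** — KS 2017
Condition G2 ("geometric bound on an unforced crossing": "there exists `C > 1` such that for any
`(φ, P) ∈ Σ`, for any stopping time `0 ≤ τ ≤ 1` and for any annulus `A = A(z₀, r, R)` where
`0 < C r ≤ R`, `P(γ[τ, 1]` makes a crossing of `A` which is contained in `A^u_τ ∣ γ[0, τ]) < 1/2`")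
for the collection `Σ_P = {(D, a, b, P D) : D a Dobrushin domain}`, with the constant made
explicit: `1 < C`, and for EVERY Dobrushin domain `D`, every first hitting time `τ_F` of a
nonempty closed set `F` (KS Lemma 2.1), EVERY annulus `A(z₀, r, R)` with `0 < r` and `C r ≤ R`
(no lower or upper bound on the scale `r`), and every measurable set `S` of pasts,
`P D ({stopAt F ∈ S} ∩ {startFrom F crosses A inside A^u_{τ_F}}) ≤ ½ · P D {stopAt F ∈ S}` —
the conditional bound in integrated form, `A^u_{τ_F} = unforcedPart D.carrier (D.pt 1) (stopAt F γ)`.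
One `C` serves all domains, all pasts and all scales (KS's uniformity over `Σ`, here over the
large collection `Σ_P`; see the module docstring, "what is printed and what is added").
Equivalently (`exists_satisfiesKSCondition_iff`): `∃ C, P.SatisfiesKSCondition C` iff
`ConditionG2 P.markedLaws`. [cite: KemppainenSmirnov2017, §2.1.3 Condition G2] -/
def SatisfiesKSCondition (P : ChordalFamily) (C : ℝ) : Prop :=
  1 < C ∧ ∀ (D : DobrushinDomain) (F : Set ℂ), IsClosed F → F.Nonempty →
    ∀ (z₀ : ℂ) (r R : ℝ), 0 < r → C * r ≤ R →
      ∀ S : Set (CurveClass ℂ), MeasurableSet S →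
        P D (CurveClass.stopAt F ⁻¹' S ∩ unforcedCrossingEvent D.carrier (D.pt 1) F z₀ r R) ≤
          2⁻¹ * P D (CurveClass.stopAt F ⁻¹' S)

/-- Unfolding `SatisfiesKSCondition`. [cite: KemppainenSmirnov2017, §2.1.3 Condition G2] -/
theorem satisfiesKSCondition_iff (P : ChordalFamily) (C : ℝ) :
    P.SatisfiesKSCondition C ↔
      1 < C ∧ ∀ (D : DobrushinDomain) (F : Set ℂ), IsClosed F → F.Nonempty →
        ∀ (z₀ : ℂ) (r R : ℝ), 0 < r → C * r ≤ R →
          ∀ S : Set (CurveClass ℂ), MeasurableSet S →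
            P D (CurveClass.stopAt F ⁻¹' S ∩
                unforcedCrossingEvent D.carrier (D.pt 1) F z₀ r R) ≤
              2⁻¹ * P D (CurveClass.stopAt F ⁻¹' S) :=
  Iff.rfl

namespace SatisfiesKSCondition

variable {P : ChordalFamily} {C C' : ℝ}

/-- The constant exceeds `1`. [cite: KemppainenSmirnov2017, §2.1.3 Condition G2] -/
theorem one_lt (h : P.SatisfiesKSCondition C) : 1 < C :=
  h.1

/-- The bound itself. [cite: KemppainenSmirnov2017, §2.1.3 Condition G2] -/
theorem bound (h : P.SatisfiesKSCondition C) (D : DobrushinDomain) {F : Set ℂ} (hF : IsClosed F)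
    (hFn : F.Nonempty) (z₀ : ℂ) {r R : ℝ} (hr : 0 < r) (hR : C * r ≤ R)
    {S : Set (CurveClass ℂ)} (hS : MeasurableSet S) :
    P D (CurveClass.stopAt F ⁻¹' S ∩ unforcedCrossingEvent D.carrier (D.pt 1) F z₀ r R) ≤
      2⁻¹ * P D (CurveClass.stopAt F ⁻¹' S) :=
  h.2 D F hF hFn z₀ r R hr hR S hS

/-- Monotonicity in the constant: a larger `C` restricts the bound to fewer (thicker) annuli.
[folklore] -/
theorem mono (h : P.SatisfiesKSCondition C) (hCC' : C ≤ C') : P.SatisfiesKSCondition C' :=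
  ⟨h.1.trans_le hCC', fun D F hF hFn z₀ r R hr hR S hS =>
    h.2 D F hF hFn z₀ r R hr ((mul_le_mul_of_nonneg_right hCC' hr.le).trans hR) S hS⟩

/-- Taking `S = univ`: the unconditional probability of an unforced crossing observed at `τ_F` is
at most half the total mass. [cite: KemppainenSmirnov2017, §2.1.3 Condition G2] -/
theorem measure_le (h : P.SatisfiesKSCondition C) (D : DobrushinDomain) {F : Set ℂ}
    (hF : IsClosed F) (hFn : F.Nonempty) (z₀ : ℂ) {r R : ℝ} (hr : 0 < r) (hR : C * r ≤ R) :
    P D (unforcedCrossingEvent D.carrier (D.pt 1) F z₀ r R) ≤ 2⁻¹ * P D univ := by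
  simpa using h.bound D hF hFn z₀ hr hR MeasurableSet.univ

/-- For probability laws: the unconditional probability of an unforced crossing observed at
`τ_F` is at most `1/2`. [cite: KemppainenSmirnov2017, §2.1.3 Condition G2] -/
theorem measure_le_half (h : P.SatisfiesKSCondition C) (D : DobrushinDomain)
    [IsProbabilityMeasure (P D)] {F : Set ℂ} (hF : IsClosed F) (hFn : F.Nonempty) (z₀ : ℂ)
    {r R : ℝ} (hr : 0 < r) (hR : C * r ≤ R) :
    P D (unforcedCrossingEvent D.carrier (D.pt 1) F z₀ r R) ≤ 2⁻¹ := by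
  simpa using h.measure_le D hF hFn z₀ hr hR

/-- **Bridge to `ConditionG2`**: the KS condition with some constant is Condition G2 for the
collection `Σ_P`. [cite: KemppainenSmirnov2017, §2.1.3 Condition G2] -/
theorem conditionG2 (h : P.SatisfiesKSCondition C) : ConditionG2 P.markedLaws := by
  refine ⟨C, h.1, ?_⟩
  rintro L ⟨D, rfl⟩ F hF hFn z₀ r R hr hR S hS
  exact h.2 D F hF hFn z₀ r R hr hR S hS

/-- **Time zero (G2 at `τ = 0` is G1).** If `P D`-almost every curve starts at `a = D.pt 0`, then
for every annulus `A(z₀, r, R)` with `0 < r`, `C r ≤ R` the probability that the curve makes a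
crossing of `A` contained in the time-zero avoidable set `A^u` (KS eq. (3)) is at most half the
total mass: take `F = {a}`, so that `τ_F = 0`, `γ[0, τ_F]` is the constant curve at `a`,
`γ[τ_F, 1] = γ` and `A^u_0 = A^u` (`a ∉ D`, a boundary point). [cite: KemppainenSmirnov2017, §1.1 Condition G1 eq. (4) and §2.1.3] -/
theorem crossingIn_unforcedPartZero_le (h : P.SatisfiesKSCondition C) (D : DobrushinDomain)
    (hsrc : ∀ᵐ γ ∂P D, γ.source = D.pt 0) (z₀ : ℂ) {r R : ℝ} (hr : 0 < r) (hR : C * r ≤ R) :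
    P D (CurveClass.crossingIn z₀ r R (unforcedPartZero D.carrier (D.pt 0) (D.pt 1) z₀ r R)) ≤
      2⁻¹ * P D univ := by
  have ha : D.pt 0 ∉ D.carrier := fun hmem =>
    (Set.disjoint_left.1 (Set.disjoint_iff_inter_eq_empty.2 D.isOpen.inter_frontier_eq) hmem)
      (D.pt_mem_frontier 0)
  have hae : (CurveClass.crossingIn z₀ r R (unforcedPartZero D.carrier (D.pt 0) (D.pt 1) z₀ r R)
        : Set (CurveClass ℂ)) =ᵐ[P D]
      unforcedCrossingEvent D.carrier (D.pt 1) {D.pt 0} z₀ r R := by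
    filter_upwards [hsrc] with c hc
    exact propext
      (mem_unforcedCrossingEvent_iff_of_source_eq ha (mem_singleton _) hc).symm
  rw [measure_congr hae]
  exact h.measure_le D isClosed_singleton (singleton_nonempty _) z₀ hr hR

/-- **G2 ⇒ G1 for chordal families**: if `P` is chordal (probability laws carried by curves from
`a` to `b` in `D̄`), the KS condition with constant `C` gives Condition G1 (time zero, KS eq. (4))
for `Σ_P` with the same constant. [cite: KemppainenSmirnov2017, §1.1 Condition G1 eq. (4)] -/
theorem conditionG1 (h : P.SatisfiesKSCondition C) (hP : P.IsChordal) :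
    ConditionG1 P.markedLaws := by
  refine ⟨C, h.1, ?_⟩
  rintro L ⟨D, rfl⟩ z₀ r R hr hR
  obtain ⟨hprob, hae⟩ := hP D
  have hsrc : ∀ᵐ γ ∂P D, γ.source = D.pt 0 := hae.mono fun γ hγ => hγ.1
  simpa using h.crossingIn_unforcedPartZero_le D hsrc z₀ hr hR

end SatisfiesKSCondition

/-- From Condition G2 for `Σ_P` to the KS condition with some constant. [cite: KemppainenSmirnov2017, §2.1.3 Condition G2] -/
theorem satisfiesKSCondition_of_conditionG2 {P : ChordalFamily} (h : ConditionG2 P.markedLaws) :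
    ∃ C, P.SatisfiesKSCondition C := by
  obtain ⟨C, hC, hfam⟩ := h
  exact ⟨C, hC, fun D => hfam _ (P.markedLaw_mem_markedLaws D)⟩

/-- **`∃ C, SatisfiesKSCondition P C` is exactly `ConditionG2` of the collection `Σ_P`** (the form
inlined in route CardyScaleErgodic). [cite: KemppainenSmirnov2017, §2.1.3 Condition G2] -/
theorem exists_satisfiesKSCondition_iff (P : ChordalFamily) :
    (∃ C, P.SatisfiesKSCondition C) ↔ ConditionG2 P.markedLaws :=
  ⟨fun ⟨_, h⟩ => h.conditionG2, satisfiesKSCondition_of_conditionG2⟩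

/-! ### Non-vacuity and scope -/

/-- A family whose curves `P D`-a.s. avoid the open domain `D` (e.g. run inside `∂D`) satisfies
the condition vacuously, for every `C > 1`: such curves make no crossing contained in
`A^u_τ ⊆ D` (`notMem_unforcedCrossingEvent_of_disjoint`). This records the scope of the printed
condition, which in KS is paired with the support hypothesis `γ(0, 1) ⊂ U`. [folklore] -/
theorem satisfiesKSCondition_of_ae_disjoint {P : ChordalFamily}
    (hP : ∀ D : DobrushinDomain, ∀ᵐ γ ∂P D, Disjoint γ.range D.carrier) {C : ℝ} (hC : 1 < C) :
    P.SatisfiesKSCondition C := by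
  refine ⟨hC, fun D F _ _ z₀ r R _ _ S _ => ?_⟩
  have h0 : P D (unforcedCrossingEvent D.carrier (D.pt 1) F z₀ r R) = 0 :=
    measure_eq_zero_iff_ae_notMem.2 ((hP D).mono fun c hc =>
      notMem_unforcedCrossingEvent_of_disjoint hc (D.pt 1) F z₀ r R)
  rw [measure_inter_null_of_null_right _ h0]
  exact zero_le

/-- A family of Dirac masses at constant curves satisfies the condition for every `C > 1`
(a constant curve crosses no annulus of positive modulus). [folklore] -/
theorem satisfiesKSCondition_of_dirac_const {P : ChordalFamily}
    (hP : ∀ D : DobrushinDomain, ∃ x : ℂ, P D = Measure.dirac (CurveClass.mk (Curve.const x)))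
    {C : ℝ} (hC : 1 < C) : P.SatisfiesKSCondition C := by
  refine ⟨hC, fun D F _ _ z₀ r R hr hR S _ => ?_⟩
  obtain ⟨x, hx⟩ := hP D
  have hrR : r < R := (lt_mul_of_one_lt_left hr hC).trans_le hR
  have hnot : CurveClass.mk (Curve.const x) ∉
      CurveClass.stopAt F ⁻¹' S ∩ unforcedCrossingEvent D.carrier (D.pt 1) F z₀ r R := by
    rintro ⟨-, hc⟩
    rw [mem_unforcedCrossingEvent_iff, CurveClass.startFrom_mk_const] at hc
    exact CurveClass.mk_const_notMem_crossingIn x z₀ hrR _ hc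
  rw [hx, Measure.dirac_apply, Set.indicator_of_notMem hnot]
  exact zero_le

/-- Non-vacuity: the degenerate family `tipFamily` ("stay at `a`") satisfies the KS condition
with every constant `C > 1`. [folklore] -/
theorem satisfiesKSCondition_tipFamily {C : ℝ} (hC : 1 < C) : tipFamily.SatisfiesKSCondition C :=
  satisfiesKSCondition_of_dirac_const (fun D => ⟨D.pt 0, rfl⟩) hC

/-- Scope witness: the boundary-arc family `arcFamily` ("run along the arc `(ab)` of `∂D`")
satisfies the KS condition with every constant `C > 1`, vacuously — its curves never enter the
open domain, so they make no crossing contained in an avoidable set. [folklore] -/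
theorem satisfiesKSCondition_arcFamily {C : ℝ} (hC : 1 < C) : arcFamily.SatisfiesKSCondition C := by
  refine satisfiesKSCondition_of_ae_disjoint (fun D => ?_) hC
  rw [arcFamily, ae_dirac_eq, eventually_pure, CurveClass.range_mk]
  have hfr : Disjoint (frontier D.carrier) D.carrier :=
    Set.disjoint_iff_inter_eq_empty.2
      (by rw [Set.inter_comm]; exact D.isOpen.inter_frontier_eq)
  exact hfr.mono_left ((D.range_arcCurve_subset 0).trans (D.arc_subset_frontier 0))

end ChordalFamily

end Literature.Probability.RandomPlanarGeometry
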